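import Literature.AnabelianGeometry.EtaleTheta.Discharge.Sec2CompletionIndex
import Literature.AnabelianGeometry.EtaleTheta.Discharge.Sec2CompletionNormal

/-!
# The profinite `Π`-level degrees / normality of `X̲̲ → X̲ → X` inside an AMBIENT completion (e.g. `Π̂_C`):
# transport along an open injection `j : Π^tp_X ↪ G` followed by a profinite completion `ι : G → Ĝ`

Mochizuki, *The étale theta function …* [EtTh], Publ. RIMS **45** (2009), §2, Rmk. 2.3.1 PRIMS PDF p. 38
("extracting two copies of `ℤ/lℤ`"), Def. 2.5 (i) p. 39, and the cartesian diagram `X̲̲ → X̲ → X` over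
`C̲̲ → C̲ → C` of Def. 2.1 p. 36 [cite: MochizukiEtTh2009, Rmk 2.3.1 p.38]; [SemiAnbd] §6 p. 69/73 (profinite completion
= closure) [cite: MochizukiSemiAnbd2006, §6 p.69]. PROOF-ONLY (0 definitions; cell abc-iut, layer L2, seat abc-iut-L2-t8;
the shape abc-iut-L6-t19 asked for on 2026-08-26 05:08Z: B14's ambient is a profinite completion `ι : Π^tp_C → Π̂_C`
receiving `Π^tp_X` through the open injection `j := inclX` of index `2`, not `Π̂_X` itself).

For ANY topological group `G`, profinite completion `ι : G →ₜ* Ĝ` (abc-iut-L3's `IsProfiniteCompletion`), and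
continuous INJECTIVE OPEN homomorphism `j : Π^tp_X →ₜ* G` whose image has finite index `[G : j(Π^tp_X)]`, write
`cl(H) :=` the closure in `Ĝ` of `ι(j(H))` for `H ≤ Π^tp_X`. Then (with `Π^tp_X̲ = D.GtpXu l`, `Π^tp_X̲̲ = C.Huu`):
* `ThetaSetting.index_closure_map_map_GtpXu` — `[Ĝ : cl(Π^tp_X̲)] = l · [G : j(Π^tp_X)]`;
* `DoubleUnderline.index_closure_map_map_Huu` — `[Ĝ : cl(Π^tp_X̲̲)] = l² · [G : j(Π^tp_X)]`;
* `DoubleUnderline.relIndex_closure_map_map_Huu_GtpXu` — **`[cl(Π^tp_X̲) : cl(Π^tp_X̲̲)] = l`**;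
* `DoubleUnderline.normal_closure_map_map_Huu_subgroupOf` — **`cl(Π^tp_X̲̲) ⊴ cl(Π^tp_X̲)`** given the tempered
  normality `Π^tp_X̲̲ ⊴ Π^tp_X̲` (hypothesis `hN`: in print from `μ_l ⊆ K`, [IUTchI] Def. 3.1 (c); a theorem for
  abc-iut-L2-t7's cocycle model, p422309);
* `ThetaSetting.normal_closure_map_map_GtpXu_subgroupOf` — `cl(Π^tp_X̲) ⊴ cl(Π^tp_X)` (from `Π^tp_X̲ ⊴ Π^tp_X`).
All are instances of the generic `IsProfiniteCompletion.index_topologicalClosure_map` (p422750) and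
`Subgroup.normal_subgroupOf_topologicalClosure_map` (p423651) at `U := H.map j`. Honest framing: bookkeeping only; no
side is taken on [IUTchIII] Cor. 3.12.
-/

noncomputable section

namespace Literature.AnabelianGeometry.EtaleTheta

open Literature.AnabelianGeometry.SemiGraphs

namespace ThetaSetting

universe u v

variable {p : ℕ} [Fact p.Prime] {D : ThetaSetting p} (l : ℕ)
  {G : Type u} {Ghat : Type v} [Group G] [TopologicalSpace G] [IsTopologicalGroup G]
  [Group Ghat] [TopologicalSpace Ghat] [IsTopologicalGroup Ghat] {ι : G →ₜ* Ghat}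
  (j : D.PiTemp →ₜ* G)

omit [IsTopologicalGroup G] in
/-- Transport of an open finite-index subgroup of `Π^tp_X` along an open injection `j` with finite-index image:
`j(H)` is open of index `[Π^tp_X : H] · [G : j(Π^tp_X)]`. [cite: MochizukiEtTh2009, Def 2.1 p.36] -/
theorem index_map_of_openEmbedding (hj : Function.Injective j) (H : Subgroup D.PiTemp) :
    (H.map j.toMonoidHom).index = H.index * j.toMonoidHom.range.index :=
  H.index_map_of_injective hj

/-- **`[Ĝ : cl(Π^tp_X̲)] = l · [G : j(Π^tp_X)]`** for the closure in a profinite completion `Ĝ` of `G ⊇ j(Π^tp_X)`.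
[cite: MochizukiEtTh2009, Rmk 2.3.1 p.38] -/
theorem index_closure_map_map_GtpXu (hι : IsProfiniteCompletion ι) (hj : Function.Injective j) (hjo : IsOpenMap j)
    [hr : j.toMonoidHom.range.FiniteIndex] (hl : l ≠ 0) :
    ((((D.GtpXu l).map j.toMonoidHom).map ι.toMonoidHom).topologicalClosure).index =
      l * j.toMonoidHom.range.index := by
  have hopen : IsOpen (((D.GtpXu l).map j.toMonoidHom : Subgroup G) : Set G) := hjo _ (D.isOpen_GtpXu l)
  have hidx : ((D.GtpXu l).map j.toMonoidHom).index = l * j.toMonoidHom.range.index := by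
    rw [index_map_of_openEmbedding j hj, D.index_GtpXu l]
  haveI : ((D.GtpXu l).map j.toMonoidHom).FiniteIndex :=
    ⟨by rw [hidx]; exact mul_ne_zero hl hr.index_ne_zero⟩
  rw [IsProfiniteCompletion.index_topologicalClosure_map hι _ hopen, hidx]

omit [IsTopologicalGroup G] in
/-- **`cl(Π^tp_X̲) ⊴ cl(Π^tp_X)`** inside `Ĝ` (from `Π^tp_X̲ ⊴ Π^tp_X`, "`X̲ → X` is Galois", Rmk. 2.1.1).
[cite: MochizukiEtTh2009, Rmk 2.1.1 p.36] -/
theorem normal_closure_map_map_GtpXu_subgroupOf :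
    (((((D.GtpXu l).map j.toMonoidHom).map ι.toMonoidHom).topologicalClosure).subgroupOf
      ((((⊤ : Subgroup D.PiTemp).map j.toMonoidHom).map ι.toMonoidHom).topologicalClosure)).Normal := by
  haveI : ((D.GtpXu l).subgroupOf (⊤ : Subgroup D.PiTemp)).Normal := inferInstance
  have h := Subgroup.normal_subgroupOf_topologicalClosure_map (ι.toMonoidHom.comp j.toMonoidHom)
    (le_top : D.GtpXu l ≤ ⊤) this
  rwa [← Subgroup.map_map, ← Subgroup.map_map] at h

namespace EtaleThetaData.DoubleUnderline

variable {E : D.EtaleThetaData} {l} (C : E.DoubleUnderline l)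

/-- **`[Ĝ : cl(Π^tp_X̲̲)] = l² · [G : j(Π^tp_X)]`**. [cite: MochizukiEtTh2009, Rmk 2.3.1 p.38] -/
theorem index_closure_map_map_Huu (hι : IsProfiniteCompletion ι) (hj : Function.Injective j) (hjo : IsOpenMap j)
    [hr : j.toMonoidHom.range.FiniteIndex] :
    (((C.Huu.map j.toMonoidHom).map ι.toMonoidHom).topologicalClosure).index = l ^ 2 * j.toMonoidHom.range.index := by
  have hopen : IsOpen (((C.Huu.map j.toMonoidHom : Subgroup G)) : Set G) := hjo _ C.isOpen_Huu
  have hidx : (C.Huu.map j.toMonoidHom).index = l ^ 2 * j.toMonoidHom.range.index := by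
    rw [index_map_of_openEmbedding j hj, C.index_Huu]
  haveI : (C.Huu.map j.toMonoidHom).FiniteIndex :=
    ⟨by rw [hidx]; exact mul_ne_zero (pow_ne_zero 2 C.l_ne_zero) hr.index_ne_zero⟩
  rw [IsProfiniteCompletion.index_topologicalClosure_map hι _ hopen, hidx]

/-- **`[cl(Π^tp_X̲) : cl(Π^tp_X̲̲)] = l`** inside any ambient profinite completion `Ĝ` of `G ⊇ j(Π^tp_X)` ("`X̲̲ → X̲`
extracts the second copy of `ℤ/lℤ`", Rmk. 2.3.1). [cite: MochizukiEtTh2009, Rmk 2.3.1 p.38] -/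
theorem relIndex_closure_map_map_Huu_GtpXu (hι : IsProfiniteCompletion ι) (hj : Function.Injective j)
    (hjo : IsOpenMap j) [hr : j.toMonoidHom.range.FiniteIndex] :
    (((C.Huu.map j.toMonoidHom).map ι.toMonoidHom).topologicalClosure).relIndex
        ((((D.GtpXu l).map j.toMonoidHom).map ι.toMonoidHom).topologicalClosure) = l := by
  have hopen₁ : IsOpen (((C.Huu.map j.toMonoidHom : Subgroup G)) : Set G) := hjo _ C.isOpen_Huu
  have hopen₂ : IsOpen ((((D.GtpXu l).map j.toMonoidHom : Subgroup G)) : Set G) := hjo _ (D.isOpen_GtpXu l)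
  haveI : (C.Huu.map j.toMonoidHom).FiniteIndex :=
    ⟨by rw [index_map_of_openEmbedding j hj, C.index_Huu]
        exact mul_ne_zero (pow_ne_zero 2 C.l_ne_zero) hr.index_ne_zero⟩
  haveI : ((D.GtpXu l).map j.toMonoidHom).FiniteIndex :=
    ⟨by rw [index_map_of_openEmbedding j hj, D.index_GtpXu l]; exact mul_ne_zero C.l_ne_zero hr.index_ne_zero⟩
  rw [IsProfiniteCompletion.relIndex_topologicalClosure_map hι _ _ hopen₁ hopen₂
      (Subgroup.map_mono C.Huu_le_GtpXu),
    Subgroup.relIndex_map_map_of_injective _ _ hj]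
  exact C.relIndex_Huu_GtpXu

omit [IsTopologicalGroup G] in
/-- **`cl(Π^tp_X̲̲) ⊴ cl(Π^tp_X̲)`** inside `Ĝ`, from the tempered normality `Π^tp_X̲̲ ⊴ Π^tp_X̲` (hypothesis `hN`; in
print from `μ_l ⊆ K`, [IUTchI] Def. 3.1 (c); abc-iut-L2-t7's theorem for the cocycle model, p422309).
[cite: MochizukiEtTh2009, Prop 2.2 (ii) p.37] -/
theorem normal_closure_map_map_Huu_subgroupOf (hN : (C.Huu.subgroupOf (D.GtpXu l)).Normal) :
    ((((C.Huu.map j.toMonoidHom).map ι.toMonoidHom).topologicalClosure).subgroupOf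
      ((((D.GtpXu l).map j.toMonoidHom).map ι.toMonoidHom).topologicalClosure)).Normal := by
  have h := Subgroup.normal_subgroupOf_topologicalClosure_map (ι.toMonoidHom.comp j.toMonoidHom)
    C.Huu_le_GtpXu hN
  rwa [← Subgroup.map_map, ← Subgroup.map_map] at h

end EtaleThetaData.DoubleUnderline

end ThetaSetting

end Literature.AnabelianGeometry.EtaleTheta
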